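import Literature.NumberTheory.Transcendental.BoxIntegralZetaValues
import Literature.NumberTheory.Transcendental.KZMellinFibres
import Literature.NumberTheory.Transcendental.KZLogCalculusProofs

/-!
# `NormalFormPrinciple` (stmt-KontsevichZagierPeriods-3869), line `SketchIdeator1` —
# the leaf `stub_boxRigidity` in dimension two, level one: the representations `[(0,1)², P/(1 − xy)]` exist

Pure proof file (stub `exists_levelOneRep` of the dimension-two layer, lead seat c7; `--supports` the
crux). For every numerator `P ∈ ℚ[x₀, x₁]` the pair (open unit box of `ℝ²`, `x ↦ P(x)/(1 − x₀x₁)`)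
is an integral representation in the sense of the tree's Kontsevich–Zagier calculus
(`Literature.NumberTheory.Transcendental.KZ.IntegralRep 2`):

* the open box is `ℚ`-semialgebraic (`KZ.isSemialgebraic_box`);
* the integrand is a quotient of `ℚ`-polynomials whose denominator `1 − x₀x₁` is positive on the box
  (`isSemialgebraicFunOn_aeval_div_aeval`);
* absolute convergence: `P` is continuous, hence bounded on the compact cube `[0,1]²`, and the
  kernel `1/(1 − x₀x₁)` is integrable on the open box (Beukers' integral for `ζ(2)`,
  `box_integral_one_div_one_sub_mul_two`), so "bounded × integrable"
  (`MeasureTheory.IntegrableOn.continuousOn_mul_of_subset`) applies.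

Sources: M. Kontsevich, D. Zagier, *Periods* (2001), §1.1; F. Beukers, *A note on the
irrationality of ζ(2) and ζ(3)*, Bull. LMS 11 (1979). No definitions are introduced.
-/

noncomputable section

open MeasureTheory Set
open Literature.NumberTheory.Transcendental Literature.NumberTheory.Transcendental.KZ
open Literature.ModelTheory.ExponentialFields (IsSemialgebraic)

namespace Summit.KontsevichZagierPeriods.HurwitzMicroSectors.NormalFormPrinciple.PiBox.LevelOne

/-- The kernel denominator `1 − x₀x₁` is positive on the open unit box of `ℝ²`. [folklore] -/
theorem one_sub_mul_pos_of_mem_box {x : Fin 2 → ℝ} (hx : ∀ i, x i ∈ Set.Ioo (0:ℝ) 1) :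
    0 < 1 - x 0 * x 1 := by
  have h0 := hx 0
  have h1 := hx 1
  exact sub_pos.2 (mul_lt_one_of_nonneg_of_lt_one_left h0.1.le h0.2 h1.2.le)

/-- The open unit box of `ℝ²` lies in the closed unit cube `[0,1]²`. [folklore] -/
theorem box_two_subset_Icc :
    {x : Fin 2 → ℝ | ∀ i, x i ∈ Set.Ioo (0:ℝ) 1} ⊆ Set.Icc 0 1 :=
  fun _ hx => ⟨fun i => (hx i).1.le, fun i => (hx i).2.le⟩

/-- **Semialgebraicity of the level-one integrand.** For `P ∈ ℚ[x₀,x₁]`, `x ↦ P(x)/(1 − x₀x₁)` is a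
`ℚ`-semialgebraic function on the open unit box (a quotient of `ℚ`-polynomials with non-vanishing
denominator). [Kontsevich–Zagier 2001, §1.1] [folklore] -/
theorem isSemialgebraicFunOn_aeval_div_one_sub_mul (p : MvPolynomial (Fin 2) ℚ) :
    IsSemialgebraicFunOn ℚ {x : Fin 2 → ℝ | ∀ i, x i ∈ Set.Ioo (0:ℝ) 1}
      (fun x => (MvPolynomial.aeval x p : ℝ) / (1 - x 0 * x 1)) := by
  refine (isSemialgebraicFunOn_aeval_div_aeval (isSemialgebraic_box 2) p
    (1 - MvPolynomial.X 0 * MvPolynomial.X 1) fun x hx => ?_).congr fun x _ => by simp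
  simp only [map_sub, map_one, map_mul, MvPolynomial.aeval_X]
  exact (one_sub_mul_pos_of_mem_box hx).ne'

/-- **Absolute convergence of the level-one integrand.** For `P ∈ ℚ[x₀,x₁]`, `P(x)/(1 − x₀x₁)` is
integrable on the open unit box: `P` is bounded on the compact cube `[0,1]²` and `1/(1 − x₀x₁)` is
integrable there (Beukers' double integral for `ζ(2)`). [folklore] -/
theorem integrableOn_aeval_div_one_sub_mul (p : MvPolynomial (Fin 2) ℚ) :
    IntegrableOn (fun x : Fin 2 → ℝ => (MvPolynomial.aeval x p : ℝ) / (1 - x 0 * x 1))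
      {x | ∀ i, x i ∈ Set.Ioo (0:ℝ) 1} := by
  have hA : MeasurableSet {x : Fin 2 → ℝ | ∀ i, x i ∈ Set.Ioo (0:ℝ) 1} :=
    Literature.ModelTheory.ExponentialFields.IsSemialgebraic.measurableSet_holds (isSemialgebraic_box 2)
  have h := box_integral_one_div_one_sub_mul_two.1.continuousOn_mul_of_subset
    (Literature.ModelTheory.ExponentialFields.continuous_aeval_real p).continuousOn
    isCompact_Icc hA box_two_subset_Icc
  simpa only [mul_one_div] using h

/-- **E1 (existence of the level-one representation).** For every `P ∈ ℚ[x₀,x₁]` there is an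
integral representation of dimension `2` with domain the open unit box `(0,1)²` and integrand
`x ↦ P(x)/(1 − x₀x₁)` (values in `ℚ + ℚζ(2)`). [Kontsevich–Zagier 2001, §1.1] [folklore] -/
theorem exists_levelOneRep (p : MvPolynomial (Fin 2) ℚ) :
    ∃ N : IntegralRep 2, N.domain = {x | ∀ i, x i ∈ Set.Ioo (0:ℝ) 1} ∧
      N.integrand = fun x => (MvPolynomial.aeval x p : ℝ) / (1 - x 0 * x 1) :=
  ⟨⟨_, _, isSemialgebraic_box 2, isSemialgebraicFunOn_aeval_div_one_sub_mul p,
    integrableOn_aeval_div_one_sub_mul p⟩, rfl, rfl⟩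

end Summit.KontsevichZagierPeriods.HurwitzMicroSectors.NormalFormPrinciple.PiBox.LevelOne
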